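import Literature.Geometry.GeometricMeasureTheory.CubicalAverage
import Mathlib.Analysis.InnerProductSpace.PiL2
import Mathlib.Geometry.Euclidean.Volume.Measure
import Literature.Geometry.GeometricMeasureTheory.CurrentsNullSupport
import HarnessLib

/-!
# The cubical subdivision at scale `ε` in an inner product space

Support file for the proof of the named fact
`Literature.Geometry.GeometricMeasureTheory.Federer1969_compactness_integralCurrents`
(Federer–Fleming compactness, [Federer1969, 4.2.17 (2)]), continuing `CubicalSubdivision.lean`
and `CubicalAverage.lean`: transfer of Federer's standard cubical subdivision, the functions
`u_m`, the retractions `σ_m` (4.2.5–4.2.6) and the averaging lemma (4.2.7) from the model `ℝⁿ`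
to a finite-dimensional real inner product space `V` with an orthonormal basis `b`, at scale `ε`
(Federer's `μ_ε`, 4.2.8–4.2.9), in the form the deformation theorem 4.2.9 uses them.

* `Cubical.coord b`, `Cubical.uncoord b` — coordinates in `b` and their inverse, with the norm
  comparisons `‖coord x‖_∞ ≤ ‖x‖ ≤ √n ‖coord x‖_∞`; `Cubical.model b ε x = ε⁻¹ coord x`;
* `Cubical.uV b m ε` (`= ε u_m(model x)`, **`1`-Lipschitz**), `Cubical.sigmaV b m ε`
  (`= uncoord (ε σ_m(model x))`), `Cubical.skeletonV b m ε` (the scaled `m`-skeleton, closed):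
  `σ` maps `{u > 0}` into the skeleton, is the identity on it, moves points by `≤ √n ε`
  (`dist_sigmaV_self_le`), is **locally Lipschitz with constant `4 n √n ε / (u - d)`**
  (`dist_sigmaV_le`) and **`8 n √n ε / r`-Lipschitz from points of `{u ≥ r}`**
  (`dist_sigmaV_le_of_le_uV`, `lipschitzOnWith_sigmaV`), continuous on `{u > 0}`;
* faces: `Cubical.faceV b ε z` (scaled `W'(z)`), `Cubical.ballV b ε z` (an open neighbourhood),
  `Cubical.faceCenter`, `Cubical.faceDirV b z` (direction space, `finrank = faceDim z`) with the
  orthonormal frame `Cubical.faceFrame`; `ballV ∩ skeletonV m = faceV` (`dim = m`),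
  `ballV ∩ skeletonV k = ∅` (`k < dim`), `faceV` convex, `faceV ⊆ faceCenter + faceDirV` and
  `ballV ∩ (faceCenter + faceDirV) = faceV` — the hypotheses of the face form of the constancy
  theorem (`CurrentsConstancy.lean`);
* Hausdorff measure: `𝓗ᵐ(faceV z) < ∞` for `dim = m` and **`𝓗ᵐ(skeletonV k) = 0` for `k < m`**
  (every point of the `k`-skeleton lies in the face of its `signature`, of dimension `≤ k`, a
  bounded piece of a `≤ k`-plane; isometry invariance of `μHE` and
  `euclideanHausdorffMeasure_eq_zero_of_finrank_lt` of `CurrentsNullSupport.lean`);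
* `Cubical.exists_good_translateV` — the averaging lemma 4.2.7 (2) with the null-set statements of
  4.2.9 for two finite measures on `V`, in model coordinates (push-forward to the model by
  `model`, `CubicalAverage.exists_good_translate`); `Cubical.uV_add_uncoord` :
  `u^ε(x + uncoord(ε a)) = ε u(model x + a)`.

## References

* H. Federer, *Geometric Measure Theory*, Springer 1969, 4.2.5–4.2.9 (held copy
  `lit book:federernd-geometric-measure-theory`, PDF pp. 340–345) [Federer1969].
-/

noncomputable section

open Set Function Metric MeasureTheory
open scoped InnerProductSpace ENNReal Classical

namespace Literature.Geometry.GeometricMeasureTheory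

namespace Cubical

variable {V : Type*} [NormedAddCommGroup V] [InnerProductSpace ℝ V] {n : ℕ}
  (b : OrthonormalBasis (Fin n) ℝ V)

/-! ### Coordinates -/

/-- The coordinates `(⟪bᵢ, x⟫)ᵢ ∈ ℝⁿ` of `x` in the orthonormal basis `b`. [folklore] -/
def coord (x : V) : Fin n → ℝ := fun i => ⟪b i, x⟫_ℝ

/-- The vector with coordinates `v`: `Σ vᵢ bᵢ`. [folklore] -/
def uncoord (v : Fin n → ℝ) : V := ∑ i, v i • b i

/-- Unfolding `coord`. [folklore] -/
@[simp] theorem coord_apply (x : V) (i : Fin n) : coord b x i = ⟪b i, x⟫_ℝ := rfl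

/-- `coord` is additive. [folklore] -/
theorem coord_add (x y : V) : coord b (x + y) = coord b x + coord b y := by
  ext i; simp [inner_add_right]

/-- `coord` respects subtraction. [folklore] -/
theorem coord_sub (x y : V) : coord b (x - y) = coord b x - coord b y := by
  ext i; simp [inner_sub_right]

/-- `coord` is homogeneous. [folklore] -/
theorem coord_smul (c : ℝ) (x : V) : coord b (c • x) = c • coord b x := by
  ext i; simp [inner_smul_right]

/-- `uncoord ∘ coord = id`. [folklore] -/
@[simp] theorem uncoord_coord (x : V) : uncoord b (coord b x) = x := by
  simp only [uncoord, coord_apply]; exact b.sum_repr' x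

/-- `coord ∘ uncoord = id`. [folklore] -/
@[simp] theorem coord_uncoord (v : Fin n → ℝ) : coord b (uncoord b v) = v := by
  ext i
  simp only [coord_apply, uncoord, inner_sum, inner_smul_right]
  rw [Finset.sum_eq_single i]
  · rw [orthonormal_iff_ite.1 b.orthonormal i i, if_pos rfl, mul_one]
  · intro j _ hji
    rw [orthonormal_iff_ite.1 b.orthonormal i j, if_neg (Ne.symm hji), mul_zero]
  · intro h; exact absurd (Finset.mem_univ i) h

/-- `uncoord` is additive. [folklore] -/
theorem uncoord_add (v w : Fin n → ℝ) : uncoord b (v + w) = uncoord b v + uncoord b w := by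
  simp [uncoord, add_smul, Finset.sum_add_distrib]

/-- `uncoord` respects subtraction. [folklore] -/
theorem uncoord_sub (v w : Fin n → ℝ) : uncoord b (v - w) = uncoord b v - uncoord b w := by
  simp [uncoord, sub_smul, Finset.sum_sub_distrib]

/-- `uncoord` is homogeneous. [folklore] -/
theorem uncoord_smul (c : ℝ) (v : Fin n → ℝ) : uncoord b (c • v) = c • uncoord b v := by
  simp [uncoord, Finset.smul_sum, smul_smul]

/-- The bijection `coord` is injective. [folklore] -/
theorem coord_injective : Injective (coord b) := fun x y h => by
  rw [← uncoord_coord b x, ← uncoord_coord b y, h]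

/-- `|⟪bᵢ, x⟫| ≤ ‖x‖`: the sup norm of the coordinates is at most the norm. [folklore] -/
theorem norm_coord_le (x : V) : ‖coord b x‖ ≤ ‖x‖ := by
  refine (pi_norm_le_iff_of_nonneg (norm_nonneg x)).2 fun i => ?_
  rw [coord_apply, Real.norm_eq_abs]
  calc |⟪b i, x⟫_ℝ| ≤ ‖b i‖ * ‖x‖ := abs_real_inner_le_norm _ _
    _ = ‖x‖ := by rw [b.orthonormal.1 i, one_mul]

/-- `‖x‖ ≤ √n ‖coord x‖_∞`. [folklore] -/
theorem norm_le_sqrt_mul_norm_coord (x : V) : ‖x‖ ≤ Real.sqrt n * ‖coord b x‖ := by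
  have h := b.norm_le_card_mul_iSup_norm_inner x
  rw [Fintype.card_fin] at h
  refine h.trans (mul_le_mul_of_nonneg_left ?_ (Real.sqrt_nonneg _))
  refine Real.iSup_le (fun i => ?_) (norm_nonneg _)
  exact norm_le_pi_norm (coord b x) i

/-- `coord` is `1`-Lipschitz. [folklore] -/
theorem dist_coord_le (x y : V) : dist (coord b x) (coord b y) ≤ dist x y := by
  rw [dist_eq_norm, dist_eq_norm, ← coord_sub]; exact norm_coord_le b _

/-- `dist x y ≤ √n dist (coord x) (coord y)`. [folklore] -/
theorem dist_le_sqrt_mul_dist_coord (x y : V) : dist x y ≤ Real.sqrt n * dist (coord b x) (coord b y) := by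
  rw [dist_eq_norm, dist_eq_norm, ← coord_sub]; exact norm_le_sqrt_mul_norm_coord b _

/-- `uncoord` is `√n`-Lipschitz. [folklore] -/
theorem dist_uncoord_le (v w : Fin n → ℝ) : dist (uncoord b v) (uncoord b w) ≤ Real.sqrt n * dist v w := by
  have := dist_le_sqrt_mul_dist_coord b (uncoord b v) (uncoord b w)
  rwa [coord_uncoord, coord_uncoord] at this

/-- `coord` is continuous. [folklore] -/
theorem continuous_coord : Continuous (coord b) :=
  continuous_pi fun _ => continuous_const.inner continuous_id

/-- `uncoord` is continuous. [folklore] -/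
theorem continuous_uncoord : Continuous (uncoord b) :=
  continuous_finsetSum _ fun i _ => (continuous_apply i).smul continuous_const

/-! ### The scaled functions `u_m^ε` and retractions `σ_m^ε` on `V` -/

variable (m : ℕ) (ε : ℝ)

/-- The model point of `x` at scale `ε`: `ε⁻¹ · coord x ∈ ℝⁿ`. [cite: Federer1969, 4.2.8] -/
def model (x : V) : Fin n → ℝ := ε⁻¹ • coord b x

/-- **`u_m` at scale `ε` on `V`**: `u_m^ε(x) = ε u_m(x/ε)` in coordinates. [cite: Federer1969, 4.2.8–4.2.9] -/
def uV (x : V) : ℝ := ε * u m (model b ε x)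

/-- **`σ_m` at scale `ε` on `V`**: `σ_m^ε = μ_ε ∘ σ_m ∘ μ_{1/ε}` in coordinates. [cite: Federer1969, 4.2.8–4.2.9] -/
def sigmaV (x : V) : V := uncoord b (ε • sigma m (model b ε x))

/-- The scaled `m`-skeleton on `V`. [cite: Federer1969, 4.2.9 (5)] -/
def skeletonV : Set V := {x | model b ε x ∈ skeleton n m}

variable {m ε}

/-- Unfolding `model`. [folklore] -/
theorem model_apply (x : V) : model b ε x = ε⁻¹ • coord b x := rfl

/-- `dist (model x) (model y) = ε⁻¹ dist (coord x) (coord y)`. [folklore] -/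
theorem dist_model (hε : 0 < ε) (x y : V) : dist (model b ε x) (model b ε y) = ε⁻¹ * dist (coord b x) (coord b y) := by
  rw [model, model, dist_smul₀, Real.norm_eq_abs, abs_of_pos (inv_pos.2 hε)]

/-- `model` is `ε⁻¹`-Lipschitz. [folklore] -/
theorem dist_model_le (hε : 0 < ε) (x y : V) : dist (model b ε x) (model b ε y) ≤ ε⁻¹ * dist x y := by
  rw [dist_model b hε]; exact mul_le_mul_of_nonneg_left (dist_coord_le b x y) (inv_nonneg.2 hε.le)

/-- Reconstruction: `x = uncoord (ε · model x)`. [folklore] -/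
theorem uncoord_smul_model (hε : ε ≠ 0) (x : V) : uncoord b (ε • model b ε x) = x := by
  rw [model, smul_smul, mul_inv_cancel₀ hε, one_smul, uncoord_coord]

/-- `model (uncoord (ε v)) = v`. [folklore] -/
theorem model_uncoord_smul (hε : ε ≠ 0) (v : Fin n → ℝ) : model b ε (uncoord b (ε • v)) = v := by
  rw [model, coord_uncoord, smul_smul, inv_mul_cancel₀ hε, one_smul]

/-- In the model, `σ^ε` is `σ`. [cite: Federer1969, 4.2.8] -/
theorem model_sigmaV (hε : ε ≠ 0) (x : V) : model b ε (sigmaV b m ε x) = sigma m (model b ε x) :=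
  model_uncoord_smul b hε _

/-- `u^ε ≥ 0`. [cite: Federer1969, 4.2.6] -/
theorem uV_nonneg (hε : 0 ≤ ε) (x : V) : 0 ≤ uV b m ε x := mul_nonneg hε (u_nonneg m _)

/-- `u^ε ≤ ε`. [cite: Federer1969, 4.2.6] -/
theorem uV_le (hε : 0 ≤ ε) (x : V) : uV b m ε x ≤ ε := by
  have := mul_le_mul_of_nonneg_left (u_le_one m (model b ε x)) hε
  rwa [mul_one] at this

/-- **`Lip(u_m^ε) ≤ 1`**. [cite: Federer1969, 4.2.6] -/
theorem abs_uV_sub_uV_le (hε : 0 < ε) (x y : V) : |uV b m ε x - uV b m ε y| ≤ dist x y := by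
  rw [uV, uV, ← mul_sub, abs_mul, abs_of_pos hε]
  calc ε * |u m (model b ε x) - u m (model b ε y)| ≤ ε * dist (model b ε x) (model b ε y) :=
        mul_le_mul_of_nonneg_left (abs_u_sub_u_le m _ _) hε.le
    _ ≤ ε * (ε⁻¹ * dist x y) := mul_le_mul_of_nonneg_left (dist_model_le b hε x y) hε.le
    _ = dist x y := by rw [← mul_assoc, mul_inv_cancel₀ hε.ne', one_mul]

/-- `u^ε` is `1`-Lipschitz. [cite: Federer1969, 4.2.6] -/
theorem lipschitzWith_uV (hε : 0 < ε) : LipschitzWith 1 (uV b m ε) :=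
  LipschitzWith.of_dist_le_mul fun x y => by
    rw [NNReal.coe_one, one_mul, Real.dist_eq]; exact abs_uV_sub_uV_le b hε x y

/-- `u^ε` is continuous. [cite: Federer1969, 4.2.6] -/
theorem continuous_uV (hε : 0 < ε) : Continuous (uV b m ε) := (lipschitzWith_uV b hε).continuous

/-- **`σ_m^ε` maps `{u_m^ε > 0}` into the scaled `m`-skeleton.** [cite: Federer1969, 4.2.6, 4.2.9 (5)] -/
theorem sigmaV_mem_skeletonV (hε : 0 < ε) {x : V} (hu : 0 < uV b m ε x) :
    sigmaV b m ε x ∈ skeletonV b m ε := by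
  show model b ε (sigmaV b m ε x) ∈ skeleton n m
  rw [model_sigmaV b hε.ne']
  exact sigma_mem_skeleton (pos_of_mul_pos_right hu hε.le)

/-- **`σ_m^ε` is the identity on the scaled `m`-skeleton.** [cite: Federer1969, 4.2.6] -/
theorem sigmaV_eq_self (hε : 0 < ε) {x : V} (hx : x ∈ skeletonV b m ε) : sigmaV b m ε x = x := by
  rw [sigmaV, sigma_eq_self_of_mem_skeleton hx, uncoord_smul_model b hε.ne']

/-- **`‖σ_m^ε(x) - x‖ ≤ √n ε`** ("`|σ_m(x) - x| ≤ n^{1/2}`" at scale `ε`). [cite: Federer1969, 4.2.6, 4.2.9 (4)] -/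
theorem dist_sigmaV_self_le (hε : 0 < ε) (x : V) : dist (sigmaV b m ε x) x ≤ Real.sqrt n * ε := by
  have e : x = uncoord b (ε • model b ε x) := (uncoord_smul_model b hε.ne' x).symm
  conv_lhs => arg 2; rw [e]
  rw [sigmaV]
  refine (dist_uncoord_le b _ _).trans (mul_le_mul_of_nonneg_left ?_ (Real.sqrt_nonneg _))
  rw [dist_smul₀, Real.norm_eq_abs, abs_of_pos hε]
  have := mul_le_mul_of_nonneg_left (dist_sigma_self_le m (model b ε x)) hε.le
  rwa [mul_one] at this

/-- **Local Lipschitz estimate at scale `ε`**: for `‖x - y‖ < u_m^ε(x)`,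
`‖σ_m^ε(x) - σ_m^ε(y)‖ ≤ 4 n √n ε ‖x - y‖ / (u_m^ε(x) - ‖x - y‖)`. [cite: Federer1969, 4.2.6] -/
theorem dist_sigmaV_le (hε : 0 < ε) {x y : V} (hxy : dist x y < uV b m ε x) :
    dist (sigmaV b m ε x) (sigmaV b m ε y) ≤
      4 * n * Real.sqrt n * ε * dist x y / (uV b m ε x - dist x y) := by
  set v := model b ε x
  set w := model b ε y
  have hd : dist v w ≤ ε⁻¹ * dist x y := dist_model_le b hε x y
  have hu : uV b m ε x = ε * u m v := rfl
  have hvw : dist v w < u m v := by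
    calc dist v w ≤ ε⁻¹ * dist x y := hd
      _ < ε⁻¹ * uV b m ε x := mul_lt_mul_of_pos_left hxy (inv_pos.2 hε)
      _ = u m v := by rw [hu, ← mul_assoc, inv_mul_cancel₀ hε.ne', one_mul]
  have h1 := dist_sigma_le hvw
  have hden : 0 < uV b m ε x - dist x y := sub_pos.2 hxy
  have hden' : 0 < u m v - dist v w := sub_pos.2 hvw
  calc dist (sigmaV b m ε x) (sigmaV b m ε y)
      ≤ Real.sqrt n * dist (ε • sigma m v) (ε • sigma m w) := dist_uncoord_le b _ _
    _ = Real.sqrt n * (ε * dist (sigma m v) (sigma m w)) := by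
        rw [dist_smul₀, Real.norm_eq_abs, abs_of_pos hε]
    _ ≤ Real.sqrt n * (ε * (4 * n * dist v w / (u m v - dist v w))) := by gcongr
    _ ≤ Real.sqrt n * (ε * (4 * n * (ε⁻¹ * dist x y) / (u m v - ε⁻¹ * dist x y))) := by
        gcongr Real.sqrt n * (ε * ?_)
        -- monotone in the distance
        have hden'' : 0 < u m v - ε⁻¹ * dist x y := by
          have : ε⁻¹ * dist x y < u m v := by
            calc ε⁻¹ * dist x y < ε⁻¹ * uV b m ε x := mul_lt_mul_of_pos_left hxy (inv_pos.2 hε)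
              _ = u m v := by rw [hu, ← mul_assoc, inv_mul_cancel₀ hε.ne', one_mul]
          linarith
        rw [div_le_div_iff₀ hden' hden'']
        have h4 : (0 : ℝ) ≤ 4 * n := by positivity
        nlinarith [mul_le_mul_of_nonneg_left hd h4, dist_nonneg (x := v) (y := w),
          mul_nonneg h4 (dist_nonneg (x := v) (y := w)), u_nonneg m v]
    _ = 4 * n * Real.sqrt n * ε * dist x y / (uV b m ε x - dist x y) := by
        rw [hu]
        field_simp

/-- **`σ_m^ε` is Lipschitz on `{u_m^ε ≥ r}`** with constant `8 n √n ε / r` (`0 < r`; only the base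
point needs `u_m^ε ≥ r`): nearby pairs by the local estimate, distant pairs because `σ_m^ε` moves
points by at most `√n ε`. [cite: Federer1969, 4.2.6] -/
theorem dist_sigmaV_le_of_le_uV (hε : 0 < ε) (hn : 0 < n) {r : ℝ} (hr : 0 < r) {x : V}
    (hx : r ≤ uV b m ε x) (y : V) :
    dist (sigmaV b m ε x) (sigmaV b m ε y) ≤ 8 * n * Real.sqrt n * ε / r * dist x y := by
  have hrε : r ≤ ε := hx.trans (uV_le b hε.le x)
  have hn1 : (1 : ℝ) ≤ n := by exact_mod_cast hn
  have hsn1 : 1 ≤ Real.sqrt n := by rw [← Real.sqrt_one]; exact Real.sqrt_le_sqrt hn1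
  by_cases hclose : dist x y < r / 2
  · have hxy : dist x y < uV b m ε x := by linarith
    refine (dist_sigmaV_le b hε hxy).trans ?_
    have hden : r / 2 ≤ uV b m ε x - dist x y := by linarith
    rw [div_le_iff₀ (by linarith)]
    calc 4 * n * Real.sqrt n * ε * dist x y = (8 * n * Real.sqrt n * ε / r * dist x y) * (r / 2) := by
          field_simp; ring
      _ ≤ 8 * n * Real.sqrt n * ε / r * dist x y * (uV b m ε x - dist x y) :=
          mul_le_mul_of_nonneg_left hden (by positivity)
  · rw [not_lt] at hclose
    calc dist (sigmaV b m ε x) (sigmaV b m ε y)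
        ≤ dist (sigmaV b m ε x) x + dist x y + dist y (sigmaV b m ε y) := dist_triangle4 _ _ _ _
      _ ≤ Real.sqrt n * ε + dist x y + Real.sqrt n * ε := by
          rw [dist_comm y]
          exact add_le_add (add_le_add (dist_sigmaV_self_le b hε x) le_rfl) (dist_sigmaV_self_le b hε y)
      _ ≤ 8 * n * Real.sqrt n * ε / r * dist x y := by
          -- `2 √n ε + d ≤ (8 n √n ε / r) d` since `d ≥ r/2`, `ε ≥ r`, `n ≥ 1`
          rw [div_mul_eq_mul_div, le_div_iff₀ hr]
          have hd : 0 ≤ dist x y := dist_nonneg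
          nlinarith [mul_le_mul_of_nonneg_left hclose (by positivity : (0 : ℝ) ≤ n * Real.sqrt n * ε),
            mul_le_mul_of_nonneg_left hrε (by positivity : (0 : ℝ) ≤ dist x y),
            mul_nonneg (mul_nonneg (sub_nonneg.2 hn1) (sub_nonneg.2 hsn1)) (mul_nonneg hε.le hd),
            mul_nonneg (sub_nonneg.2 hn1) (mul_nonneg hε.le hd),
            mul_nonneg (sub_nonneg.2 hsn1) (mul_nonneg hε.le hd)]

/-- `σ^ε` is Lipschitz on `{u^ε ≥ r}`. [cite: Federer1969, 4.2.6] -/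
theorem lipschitzOnWith_sigmaV (hε : 0 < ε) (hn : 0 < n) {r : ℝ} (hr : 0 < r) :
    LipschitzOnWith (Real.toNNReal (8 * n * Real.sqrt n * ε / r)) (sigmaV b m ε)
      {x | r ≤ uV b m ε x} :=
  LipschitzOnWith.of_dist_le_mul fun x hx y _ => by
    rw [Real.coe_toNNReal _ (by positivity)]
    exact dist_sigmaV_le_of_le_uV b hε hn hr hx y

/-- Continuity of `σ_m^ε` on `{u_m^ε > 0}`. [cite: Federer1969, 4.2.6] -/
theorem continuousOn_sigmaV (hε : 0 < ε) (hn : 0 < n) :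
    ContinuousOn (sigmaV b m ε) {x | 0 < uV b m ε x} := by
  intro x hx
  have hr : 0 < uV b m ε x / 2 := half_pos hx
  have hS : {y | uV b m ε x / 2 ≤ uV b m ε y} ∈ nhds x :=
    (continuous_uV b hε).continuousAt.preimage_mem_nhds (Ici_mem_nhds (by linarith))
  exact ((lipschitzOnWith_sigmaV b hε hn hr).continuousOn.continuousAt hS).continuousWithinAt

/-! ### Faces and skeleta on `V` -/

/-- `model` is continuous. [folklore] -/
theorem continuous_model : Continuous (model b ε) := by
  have : model b ε = fun x => ε⁻¹ • coord b x := rfl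
  rw [this]
  exact (continuous_coord b).const_smul (ε⁻¹ : ℝ)

/-- The scaled skeleta are closed. [cite: Federer1969, 4.2.5] -/
theorem isClosed_skeletonV : IsClosed (skeletonV b m ε) :=
  (isClosed_skeleton n m).preimage (continuous_model b)

variable (ε)

/-- The scaled open face `μ_ε W'(z)` on `V`. [cite: Federer1969, 4.2.5] -/
def faceV (z : Fin n → ℤ) : Set V := {x | model b ε x ∈ face z}

/-- The open unit sup-ball about the scaled lattice point: an open neighbourhood of the face.
[cite: Federer1969, 4.2.5] -/
def ballV (z : Fin n → ℤ) : Set V := {x | model b ε x ∈ Metric.ball (fun i => (z i : ℝ)) 1}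

/-- The scaled lattice point `μ_ε z`, a point of the face `μ_ε W'(z)`. [folklore] -/
def faceCenter (z : Fin n → ℤ) : V := uncoord b (ε • fun i => (z i : ℝ))

variable {ε}

/-- The direction space of the face `W'(z)` inside `V`: the span of the basis vectors `bᵢ` with
`zᵢ` even. [cite: Federer1969, 4.2.5] -/
def faceDirV (z : Fin n → ℤ) : Submodule ℝ V :=
  Submodule.span ℝ (Set.range fun i : {i : Fin n // Even (z i)} => b i.1)

/-- `ballV` is open. [folklore] -/
theorem isOpen_ballV (z : Fin n → ℤ) : IsOpen (ballV b ε z) :=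
  Metric.isOpen_ball.preimage (continuous_model b)

/-- **The ball about the lattice point meets the scaled `m`-skeleton in the face.** [cite: Federer1969, 4.2.5] -/
theorem ballV_inter_skeletonV_eq_faceV {z : Fin n → ℤ} (hz : faceDim z = m) :
    ballV b ε z ∩ skeletonV b m ε = faceV b ε z := by
  ext x
  have := Set.ext_iff.1 (ball_inter_skeleton_eq_face hz) (model b ε x)
  simpa [ballV, skeletonV, faceV] using this

/-- **The ball about the lattice point misses the lower skeleta.** [cite: Federer1969, 4.2.5] -/
theorem ballV_inter_skeletonV_eq_empty {z : Fin n → ℤ} {k : ℕ} (hk : k < faceDim z) :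
    ballV b ε z ∩ skeletonV b k ε = ∅ := by
  ext x
  have := Set.ext_iff.1 (ball_inter_skeleton_eq_empty hk) (model b ε x)
  simpa [ballV, skeletonV] using this

/-- The face lies in the skeleton of its dimension. [cite: Federer1969, 4.2.5] -/
theorem faceV_subset_skeletonV (z : Fin n → ℤ) : faceV b ε z ⊆ skeletonV b (faceDim z) ε := fun _ hx =>
  face_subset_skeleton z hx

/-- The scaled lattice point lies in its face. [folklore] -/
theorem faceCenter_mem_faceV (hε : ε ≠ 0) (z : Fin n → ℤ) : faceCenter b ε z ∈ faceV b ε z := by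
  show model b ε (faceCenter b ε z) ∈ face z
  rw [faceCenter, model_uncoord_smul b hε]
  exact self_mem_face z

/-- The face as an image: `μ_ε W'(z) = uncoord (ε · W'(z))`. [folklore] -/
theorem faceV_eq_image (hε : ε ≠ 0) (z : Fin n → ℤ) :
    faceV b ε z = (fun v => uncoord b (ε • v)) '' face z := by
  ext x
  constructor
  · intro hx
    exact ⟨model b ε x, hx, uncoord_smul_model b hε x⟩
  · rintro ⟨v, hv, rfl⟩
    show model b ε (uncoord b (ε • v)) ∈ face z
    rwa [model_uncoord_smul b hε]

/-- **Faces are convex**, hence connected. [folklore] -/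
theorem convex_faceV (hε : ε ≠ 0) (z : Fin n → ℤ) : Convex ℝ (faceV b ε z) := by
  rw [faceV_eq_image b hε]
  refine (convex_face z).is_linear_image ⟨fun v w => ?_, fun c v => ?_⟩
  · rw [smul_add, uncoord_add]
  · rw [smul_comm, uncoord_smul]

/-- Faces are (pre)connected. [folklore] -/
theorem isPreconnected_faceV (hε : ε ≠ 0) (z : Fin n → ℤ) : IsPreconnected (faceV b ε z) :=
  (convex_faceV b hε z).isPreconnected

/-- **Faces are flat**: `μ_ε W'(z) ⊆ μ_ε z + faceDirV z`. [cite: Federer1969, 4.2.5] -/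
theorem faceV_subset_plane (z : Fin n → ℤ) :
    faceV b ε z ⊆ {x | x - faceCenter b ε z ∈ faceDirV b z} := by
  intro x hx
  have hodd : ∀ i, Odd (z i) → coord b x i = ε * z i := fun i hi => by
    have h := (hx i).1 hi
    simp only [model, Pi.smul_apply, smul_eq_mul] at h
    by_cases hε : ε = 0
    · -- degenerate scale: `model = 0`, so `0 = z i` is odd — then `coord` is unconstrained; but
      -- `h : 0 = z i` contradicts oddness? No: `0⁻¹ = 0` gives `0 * coord = z i`, so `z i = 0`, even.
      exfalso
      rw [hε, inv_zero, zero_mul] at h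
      have : (z i : ℝ) = 0 := h.symm
      have hz : z i = 0 := by exact_mod_cast this
      rw [hz] at hi
      exact (Int.not_odd_iff_even.2 (by decide : Even (0 : ℤ))) hi
    · field_simp at h
      linarith [h]
  -- `x - center = Σ_{even} (coord x i - ε z i) b i`
  have e : x - faceCenter b ε z = ∑ i, (coord b x i - ε * z i) • b i := by
    conv_lhs => rw [← uncoord_coord b x]
    rw [faceCenter, uncoord, uncoord, ← Finset.sum_sub_distrib]
    refine Finset.sum_congr rfl fun i _ => ?_
    rw [Pi.smul_apply, smul_eq_mul, sub_smul]
  rw [Set.mem_setOf_eq, e]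
  refine Submodule.sum_mem _ fun i _ => ?_
  rcases Int.even_or_odd (z i) with h | h
  · exact Submodule.smul_mem _ _ (Submodule.subset_span ⟨⟨i, h⟩, rfl⟩)
  · rw [hodd i h, sub_self, zero_smul]; exact Submodule.zero_mem _

/-- Conversely, on the plane of the face the ball about the lattice point cuts out exactly the face:
`B ∩ (μ_ε z + faceDirV z) = μ_ε W'(z)`. [cite: Federer1969, 4.2.5] -/
theorem ballV_inter_plane_eq_faceV (hε : 0 < ε) (z : Fin n → ℤ) :
    ballV b ε z ∩ {x | x - faceCenter b ε z ∈ faceDirV b z} = faceV b ε z := by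
  refine Set.Subset.antisymm ?_ fun x hx => ⟨?_, faceV_subset_plane b z hx⟩
  · rintro x ⟨hb, hp⟩
    rw [ballV, Set.mem_setOf_eq, Metric.mem_ball, dist_pi_lt_iff one_pos] at hb
    -- odd coordinates of `x - center` vanish on the plane
    have hodd : ∀ i, Odd (z i) → coord b (x - faceCenter b ε z) i = 0 := by
      intro i hi
      rw [Set.mem_setOf_eq] at hp
      refine Submodule.span_induction (p := fun v _ => coord b v i = 0) ?_ ?_ ?_ ?_ hp
      · rintro _ ⟨⟨j, hj⟩, rfl⟩
        rw [coord_apply, orthonormal_iff_ite.1 b.orthonormal]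
        rw [if_neg]
        rintro rfl
        exact (Int.not_even_iff_odd.2 hi) hj
      · simp
      · intro v w _ _ hv hw; rw [coord_add, Pi.add_apply, hv, hw, add_zero]
      · intro c v _ hv; rw [coord_smul, Pi.smul_apply, hv, smul_zero]
    intro i
    constructor
    · intro hi
      have h := hodd i hi
      rw [coord_sub, Pi.sub_apply, faceCenter, coord_uncoord, Pi.smul_apply, smul_eq_mul, sub_eq_zero] at h
      show ε⁻¹ * coord b x i = z i
      rw [h, ← mul_assoc, inv_mul_cancel₀ hε.ne', one_mul]
    · intro _
      have := hb i
      rwa [Real.dist_eq] at this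
  · -- `x ∈ face` gives the ball condition coordinatewise
    rw [ballV, Set.mem_setOf_eq, Metric.mem_ball, dist_pi_lt_iff one_pos]
    intro i
    rw [Real.dist_eq]
    rcases Int.even_or_odd (z i) with h' | h'
    · exact (hx i).2 h'
    · rw [(hx i).1 h', sub_self, abs_zero]; exact one_pos

/-- An orthonormal frame of the face direction: the basis vectors with even `zᵢ`, enumerated
increasingly. [folklore] -/
def faceFrame (z : Fin n → ℤ) {k : ℕ} (hz : faceDim z = k) : Fin k → V := fun j =>
  b ((Finset.univ.filter fun i => Even (z i)).orderEmbOfFin hz j)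

/-- The frame indices have even `zᵢ`. [folklore] -/
theorem faceFrame_even (z : Fin n → ℤ) {k : ℕ} (hz : faceDim z = k) (j : Fin k) :
    Even (z ((Finset.univ.filter fun i => Even (z i)).orderEmbOfFin hz j)) :=
  (Finset.mem_filter.1 (Finset.orderEmbOfFin_mem _ hz j)).2

/-- The face frame is orthonormal. [folklore] -/
theorem orthonormal_faceFrame (z : Fin n → ℤ) {k : ℕ} (hz : faceDim z = k) :
    Orthonormal ℝ (faceFrame b z hz) :=
  b.orthonormal.comp _ (Finset.orderEmbOfFin _ hz).injective

/-- The face frame lies in the face direction. [folklore] -/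
theorem faceFrame_mem (z : Fin n → ℤ) {k : ℕ} (hz : faceDim z = k) (j : Fin k) :
    faceFrame b z hz j ∈ faceDirV b z :=
  Submodule.subset_span ⟨⟨_, faceFrame_even z hz j⟩, rfl⟩

/-- `dim faceDirV z = faceDim z`. [cite: Federer1969, 4.2.5] -/
theorem finrank_faceDirV (z : Fin n → ℤ) : Module.finrank ℝ (faceDirV b z) = faceDim z := by
  have hli : LinearIndependent ℝ fun i : {i : Fin n // Even (z i)} => b i.1 :=
    (b.orthonormal.comp _ Subtype.val_injective).linearIndependent
  rw [faceDirV, finrank_span_eq_card hli, Fintype.card_subtype, faceDim]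

/-! ### Hausdorff measure of faces and lower skeleta -/

section Measure

variable [FiniteDimensional ℝ V] [MeasurableSpace V] [BorelSpace V]

omit [FiniteDimensional ℝ V] [MeasurableSpace V] [BorelSpace V] in
/-- Points of the face are within `√n ε` of its lattice point. [folklore] -/
theorem dist_faceCenter_le (hε : 0 < ε) {z : Fin n → ℤ} {x : V} (hx : x ∈ faceV b ε z) :
    dist x (faceCenter b ε z) ≤ Real.sqrt n * ε := by
  have e : x = uncoord b (ε • model b ε x) := (uncoord_smul_model b hε.ne' x).symm
  rw [e, faceCenter]
  refine (dist_uncoord_le b _ _).trans (mul_le_mul_of_nonneg_left ?_ (Real.sqrt_nonneg _))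
  rw [dist_smul₀, Real.norm_eq_abs, abs_of_pos hε]
  refine mul_le_of_le_one_right hε.le ((dist_pi_le_iff zero_le_one).2 fun i => ?_)
  rw [Real.dist_eq]
  rcases Int.even_or_odd (z i) with h | h
  · exact ((hx i).2 h).le
  · rw [(hx i).1 h, sub_self, abs_zero]; exact zero_le_one

/-- **Faces have finite `𝓗ᵐ`-measure** (`m = dim`): a bounded piece of an `m`-plane.
[cite: Federer1969, 4.2.5] -/
theorem euclideanHausdorffMeasure_faceV_lt_top (hε : 0 < ε) {z : Fin n → ℤ} (hz : faceDim z = m) :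
    (μHE[m] : Measure V) (faceV b ε z) < ⊤ := by
  set P₀ := faceDirV b z
  have hP : Module.finrank ℝ P₀ = m := (finrank_faceDirV b z).trans hz
  set ι : P₀ → V := fun y => faceCenter b ε z + (y : V) with hι
  have hiso : Isometry ι := Isometry.of_dist_eq fun y y' => by
    simp only [hι, dist_add_left, Subtype.dist_eq]
  set R := Real.sqrt n * ε
  have hsub : faceV b ε z ⊆ ι '' Metric.closedBall (0 : P₀) R := by
    intro x hx
    have hmem : x - faceCenter b ε z ∈ P₀ := faceV_subset_plane b z hx
    refine ⟨⟨x - faceCenter b ε z, hmem⟩, ?_, by simp [hι]⟩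
    rw [Metric.mem_closedBall, dist_zero_right, Submodule.coe_norm, ← dist_eq_norm]
    exact dist_faceCenter_le b hε hx
  calc (μHE[m] : Measure V) (faceV b ε z) ≤ μHE[m] (ι '' Metric.closedBall (0 : P₀) R) :=
        measure_mono hsub
    _ = (μHE[m] : Measure P₀) (Metric.closedBall (0 : P₀) R) := hiso.euclideanHausdorffMeasure_image _
    _ < ⊤ := by rw [← hP]; exact measure_closedBall_lt_top

/-- The signature lattice point of a model point: odd coordinates where `vᵢ` is an odd integer,
the nearest even integer elsewhere; `v` lies in the face of its signature. [folklore] -/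
def signature (v : Fin n → ℝ) : Fin n → ℤ := fun i =>
  if h : ∃ w : ℤ, Odd w ∧ v i = w then h.choose else evenRound (v i)

/-- A model point lies in the face of its signature. [folklore] -/
theorem mem_face_signature (v : Fin n → ℝ) : v ∈ face (signature v) := by
  intro i
  by_cases h : ∃ w : ℤ, Odd w ∧ v i = w
  · have hs : signature v i = h.choose := by simp only [signature, dif_pos h]
    refine ⟨fun _ => by rw [hs]; exact h.choose_spec.2, fun heven => ?_⟩
    rw [hs] at heven
    exact absurd h.choose_spec.1 (Int.not_odd_iff_even.2 heven)
  · have hs : signature v i = evenRound (v i) := by simp only [signature, dif_neg h]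
    refine ⟨fun hodd => ?_, fun _ => ?_⟩
    · rw [hs] at hodd; exact absurd (even_evenRound _) (Int.not_even_iff_odd.2 hodd)
    · rw [hs]
      have h1 : |offset (v i)| ≤ 1 := abs_offset_le_one _
      have h2 : |offset (v i)| ≠ 1 := fun h1' => h ((abs_offset_eq_one_iff _).1 h1')
      exact lt_of_le_of_ne h1 h2

/-- The signature of a point of `W'_k` has dimension `≤ k`. [cite: Federer1969, 4.2.5] -/
theorem faceDim_signature_le {k : ℕ} {v : Fin n → ℝ} (hv : v ∈ skeleton n k) :
    faceDim (signature v) ≤ k := by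
  have h1 : (Finset.univ.filter fun i => ∃ w : ℤ, Odd w ∧ v i = w) ⊆
      Finset.univ.filter fun i => Odd (signature v i) := by
    intro i hi
    rw [Finset.mem_filter] at hi ⊢
    refine ⟨hi.1, ?_⟩
    simp only [signature, dif_pos hi.2]
    exact hi.2.choose_spec.1
  have h2 := Finset.card_le_card h1
  rw [card_odd_eq] at h2
  rw [mem_skeleton_iff] at hv
  have : faceDim (signature v) ≤ n := by
    rw [faceDim]; exact (Finset.card_le_univ _).trans_eq (Fintype.card_fin n)
  omega

omit [FiniteDimensional ℝ V] [MeasurableSpace V] [BorelSpace V] in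
/-- The `k`-skeleton is the union of the faces of dimension `≤ k`. [cite: Federer1969, 4.2.5] -/
theorem skeletonV_subset_iUnion_faceV (k : ℕ) :
    skeletonV b k ε ⊆ ⋃ z ∈ {z : Fin n → ℤ | faceDim z ≤ k}, faceV b ε z := fun x hx =>
  Set.mem_biUnion (faceDim_signature_le hx) (mem_face_signature (model b ε x))

/-- **A face of dimension `< m` is `𝓗ᵐ`-null.** [folklore] -/
theorem euclideanHausdorffMeasure_faceV_eq_zero {z : Fin n → ℤ} (hz : faceDim z < m) :
    (μHE[m] : Measure V) (faceV b ε z) = 0 := by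
  set P₀ := faceDirV b z
  have hP : Module.finrank ℝ P₀ < m := (finrank_faceDirV b z).trans_lt hz
  set ι : P₀ → V := fun y => faceCenter b ε z + (y : V) with hι
  have hiso : Isometry ι := Isometry.of_dist_eq fun y y' => by
    simp only [hι, dist_add_left, Subtype.dist_eq]
  have hsub : faceV b ε z ⊆ ι '' Set.univ := by
    intro x hx
    exact ⟨⟨x - faceCenter b ε z, faceV_subset_plane b z hx⟩, Set.mem_univ _, by simp [hι]⟩
  refine measure_mono_null hsub ?_
  rw [hiso.euclideanHausdorffMeasure_image, euclideanHausdorffMeasure_eq_zero_of_finrank_lt hP,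
    Measure.coe_zero, Pi.zero_apply]

/-- **The lower skeleta are `𝓗ᵐ`-null**: `𝓗ᵐ(μ_ε W'_k) = 0` for `k < m` (so a rectifiable
`m`-current carries no mass on `W'_{m-1}`). [cite: Federer1969, 4.2.3, 4.2.5] -/
theorem euclideanHausdorffMeasure_skeletonV_eq_zero {k : ℕ} (hk : k < m) :
    (μHE[m] : Measure V) (skeletonV b k ε) = 0 := by
  refine measure_mono_null (skeletonV_subset_iUnion_faceV b k) ?_
  refine (measure_biUnion_null_iff (Set.to_countable _)).2 fun z hz => ?_
  exact euclideanHausdorffMeasure_faceV_eq_zero b (lt_of_le_of_lt hz hk)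

/-! ### The averaging lemma transferred to `V` -/

omit [FiniteDimensional ℝ V] in
/-- The model map is measurable. [folklore] -/
theorem measurable_model : Measurable (model b ε) := (continuous_model b).measurable

omit [FiniteDimensional ℝ V] [MeasurableSpace V] [BorelSpace V] in
/-- Translations in the model: `model (x + uncoord (ε a)) = model x + a`. [folklore] -/
theorem model_add_uncoord (hε : ε ≠ 0) (x : V) (a : Fin n → ℝ) :
    model b ε (x + uncoord b (ε • a)) = model b ε x + a := by
  rw [model, coord_add, coord_uncoord, smul_add, smul_smul, inv_mul_cancel₀ hε, one_smul, ← model_apply]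

omit [FiniteDimensional ℝ V] [MeasurableSpace V] [BorelSpace V] in
/-- `u_m^ε(x + μ_ε a) = ε u_m(model x + a)`. [cite: Federer1969, 4.2.9] -/
theorem uV_add_uncoord (hε : ε ≠ 0) (x : V) (a : Fin n → ℝ) :
    uV b m ε (x + uncoord b (ε • a)) = ε * u m (model b ε x + a) := by
  rw [uV, model_add_uncoord b hε]

omit [FiniteDimensional ℝ V] in
/-- **Existence of a good translation on `V`** (Federer 4.2.7 (2) + the null-set statements of
4.2.9, for two finite measures on `V`, in model coordinates at scale `ε`). [cite: Federer1969, 4.2.7, 4.2.9] -/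
theorem exists_good_translateV (ρ₁ ρ₂ : Measure V) [IsFiniteMeasure ρ₁] [IsFiniteMeasure ρ₂]
    (m₁ m₂ : ℕ) :
    ∃ a ∈ transCube n,
      ρ₁ {x | u m₁ (model b ε x + a) = 0} = 0 ∧ ρ₂ {x | u m₂ (model b ε x + a) = 0} = 0 ∧
      ∫⁻ x, ENNReal.ofReal (upow m₁ (model b ε x + a)) ∂ρ₁ ≤
        ENNReal.ofReal (4 * avgConst n m₁ / 2 ^ n) * ρ₁ Set.univ ∧
      ∫⁻ x, ENNReal.ofReal (upow m₂ (model b ε x + a)) ∂ρ₂ ≤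
        ENNReal.ofReal (4 * avgConst n m₂ / 2 ^ n) * ρ₂ Set.univ := by
  have hm := measurable_model b (ε := ε)
  set ρ₁' := ρ₁.map (model b ε)
  set ρ₂' := ρ₂.map (model b ε)
  haveI : IsFiniteMeasure ρ₁' := Measure.isFiniteMeasure_map ρ₁ _
  haveI : IsFiniteMeasure ρ₂' := Measure.isFiniteMeasure_map ρ₂ _
  obtain ⟨a, ha, h1, h2, h3, h4⟩ := exists_good_translate ρ₁' ρ₂' m₁ m₂
  have hmeas : ∀ k, MeasurableSet {w : Fin n → ℝ | u k (w + a) = 0} := fun k =>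
    (isClosed_eq ((continuous_u k).comp (continuous_id.add continuous_const)) continuous_const).measurableSet
  have hmeas' : ∀ k, Measurable fun w : Fin n → ℝ => ENNReal.ofReal (upow k (w + a)) := fun k =>
    ENNReal.measurable_ofReal.comp ((measurable_upow k).comp (measurable_id.add measurable_const))
  refine ⟨a, ha, ?_, ?_, ?_, ?_⟩
  · rw [Measure.map_apply hm (hmeas m₁)] at h1; exact h1
  · rw [Measure.map_apply hm (hmeas m₂)] at h2; exact h2
  · rw [lintegral_map (hmeas' m₁) hm, Measure.map_apply hm MeasurableSet.univ] at h3; exact h3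
  · rw [lintegral_map (hmeas' m₂) hm, Measure.map_apply hm MeasurableSet.univ] at h4; exact h4

end Measure

end Cubical

end Literature.Geometry.GeometricMeasureTheory
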